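import Literature.NumberTheory.Irrationality.PAdicZetaValues.TwoAdicBernoulliVolkenbornProofs
import Mathlib.NumberTheory.Padics.RingHoms
import HarnessLib

/-!
# `ζ_p(1 − m)` over the unit classes: `p^{e+1}(1 − p^{m−1}) B_m = Σ_{a < p^{e+1}, p ∤ a} ∫_{ℤ_p} (a + p^{e+1}t)^m dt`,
# and the uniform `S¹` estimate along `m ≡ −e (mod (p−1)p^M)`

L. Lai, *On the irrationality of certain 2-adic zeta values*, Int. J. Number Theory 21 (2025) =
arXiv:2304.00816 [Lai2025TwoAdicZeta], §2.3 (p. 6): "`L_p(s, χ) := (⟨M⟩^{1−s}/M) Σ_{a, p∤a} χ(a)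
ζ_p(s, a/M)` … The functions `L_p(·, ω^0), …, L_p(·, ω^{p−2})` are exactly the `p − 1` branches
interpolating the values of the Riemann zeta function at negative integers … we define
`ζ_p(s) := L_p(s, ω^{1−s})`", and **Lemma 2.7**: "for any odd integer `j ≥ 3`,
`ζ_p(j) = (1/q_p) Σ_{a=0, p∤a}^{q_p−1} ω(a)^{1−j} ζ_p(j, a/q_p)`."  In the tree `ζ_p(j)`
(`PAdicZetaValues/Basic.lean`) IS the interpolation limit `lim_N −(1 − p^{m_N−1})B_{m_N}/m_N`,
`m_N = (p−1)p^{N+j} + 1 − j`; the sibling `HurwitzLemma27Proofs.lean` discharges Lemma 2.7 for every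
prime by PROVING that interpolation.  This file supplies its two Volkenborn ingredients, general `p`
(the case `p = 2`, `p^{e+1} = 4`, was done by hand in `TwoAdicBernoulliVolkenbornProofs` /
`HurwitzLemma27TwoProofs`):

* §1 `tendsto_sum_unitClasses_volkenbornSum_pow`: for `m ≥ 1`,
  `Σ_{a<p^{e+1}, p∤a} S_r((a + p^{e+1}t)^m) → p^{e+1}(1 − p^{m−1}) B_m` — the value
  `−m ζ_p(1−m) = (1 − p^{m−1})B_m` as a sum of Volkenborn integrals over the unit residue classes
  modulo `p^{e+1}` (digit decomposition `volkenbornSum_add_eq_sum_residues` at `p^{e+1}` and, for the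
  multiples of `p`, at `p^e`; `b_m = ∫ t^m dt` from the tree's `tendsto_volkenbornSum_pow`, Robert V.5.4).
* §2 `norm_volkenbornSum_unit_pow_sub_zpow_le`: for a unit `c`, `‖q‖ ≤ p⁻¹` and
  `m + e = (p−1)p^M`, UNIFORMLY in `r`: `‖S_r((c+qt)^m) − S_r((c+qt)^{−e})‖ ≤ p·p^{−M}` (the tree's
  `norm_volkenbornSum_le`, Robert V.5.1 Prop. 1 (a); Fermat `‖u^{p−1} − 1‖ ≤ p⁻¹` via `ℤ_p → ℤ/p` and the
  lifting `‖a^p − b^p‖ ≤ p⁻¹‖a − b‖`, folklore, private).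

CONVENTIONS: `B_m` = Mathlib's `bernoulli` (`B₁ = −½`), as in `Basic.lean`'s `zetaNeg` and the tree's
`tendsto_volkenbornSum_pow`.  Theorems only; no statement file is touched.
Cell pub-zeta5 (HONEST FRAMING: systematic search; no irrationality claim unless kernel-certified):
`p`-adic bookkeeping for the RECORD vocabulary; nothing here bears on `ζ(5) ∈ ℝ`.
-/

noncomputable section

open Filter Finset
open scoped Topology

namespace Literature.NumberTheory.Irrationality.PAdicZetaValues

open Literature.NumberTheory.LocalFields

variable {p : ℕ} [hp : Fact p.Prime]

/-! ## §1. `(1 − p^{m−1}) B_m` over the unit classes modulo `p^{e+1}` -/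

/-- The multiples of `p` below `p·n` are `p·k`, `k < n`. [folklore] -/
private theorem filter_dvd_range_mul_eq_image (n : ℕ) :
    (range (p * n)).filter (fun c => p ∣ c) = (range n).image (fun k => p * k) := by
  ext c
  simp only [mem_filter, mem_range, mem_image]
  constructor
  · rintro ⟨hc, k, rfl⟩
    exact ⟨k, Nat.lt_of_mul_lt_mul_left hc, rfl⟩
  · rintro ⟨k, hk, rfl⟩
    exact ⟨(Nat.mul_lt_mul_left hp.out.pos).mpr hk, dvd_mul_right p k⟩

/-- Reindexing a sum over the multiples of `p` below `p·n`. [folklore] -/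
private theorem sum_filter_dvd_range_mul {M : Type*} [AddCommMonoid M] (F : ℕ → M) (n : ℕ) :
    ∑ c ∈ (range (p * n)).filter (fun c => p ∣ c), F c = ∑ k ∈ range n, F (p * k) := by
  rw [filter_dvd_range_mul_eq_image, Finset.sum_image]
  intro a _ b _ h
  exact Nat.eq_of_mul_eq_mul_left hp.out.pos h

/-- **`p^{e+1}(1 − p^{m−1}) B_m = Σ_{a<p^{e+1}, p∤a} ∫_{ℤ_p} (a + p^{e+1}t)^m dt` (`m ≥ 1`)**, as the limit
of the Riemann sums: the value `(1 − p^{m−1})B_m = −m·ζ_p(1−m)` of the `p`-deprived zeta function as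
a sum over the unit residue classes — the Volkenborn form of "`L_p(s, χ) = (⟨M⟩^{1−s}/M) Σ_{p∤a} χ(a)
ζ_p(s, a/M)` … interpolating the values of the Riemann zeta function at negative integers".
[cite: Lai2025TwoAdicZeta, §2.3 (p. 6, definition of `L_p` and the interpolation property)] -/
theorem tendsto_sum_unitClasses_volkenbornSum_pow (e : ℕ) {m : ℕ} (hm : m ≠ 0) :
    Tendsto (fun r => ∑ a ∈ (range (p ^ (e + 1))).filter (fun a => ¬ p ∣ a),
        volkenbornSum p (fun t : ℤ_[p] =>
          ((a : ℚ_[p]) + ((p ^ (e + 1) : ℕ) : ℚ_[p]) * (t : ℚ_[p])) ^ m) r)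
      atTop (𝓝 (((p ^ (e + 1) : ℕ) : ℚ_[p]) * (1 - (p : ℚ_[p]) ^ (m - 1)) *
        ((bernoulli m : ℚ) : ℚ_[p]))) := by
  set g : ℤ_[p] → ℚ_[p] := fun t => ((t : ℚ_[p])) ^ m with hg
  have hp0 : (p : ℚ_[p]) ≠ 0 := by exact_mod_cast hp.out.ne_zero
  -- the class function in terms of `g`
  have hfun : ∀ (n : ℕ) (c : ℕ), (fun t : ℤ_[p] => g ((c : ℤ_[p]) + ((p ^ n : ℕ) : ℤ_[p]) * t)) =
      fun t : ℤ_[p] => ((c : ℚ_[p]) + ((p ^ n : ℕ) : ℚ_[p]) * (t : ℚ_[p])) ^ m := by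
    intro n c
    funext t
    simp only [hg, PadicInt.coe_add, PadicInt.coe_mul, PadicInt.coe_natCast]
  -- §1.1 all classes: `Σ_{c<p^{e+1}} S_r((c + p^{e+1}t)^m) = p^{e+1} S_{r+e+1}(t^m)`
  have hall : ∀ r, ∑ c ∈ range (p ^ (e + 1)),
      volkenbornSum p (fun t : ℤ_[p] => ((c : ℚ_[p]) + ((p ^ (e + 1) : ℕ) : ℚ_[p]) * (t : ℚ_[p])) ^ m) r =
      (p : ℚ_[p]) ^ (e + 1) * volkenbornSum p g (r + (e + 1)) := by
    intro r
    rw [volkenbornSum_add_eq_sum_residues g r (e + 1), smul_eq_mul,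
      mul_inv_cancel_left₀ (pow_ne_zero _ hp0)]
    exact Finset.sum_congr rfl fun c _ => by rw [hfun]
  -- §1.2 the multiples of `p`: `Σ_{p ∣ c} S_r((c + p^{e+1}t)^m) = p^m · p^e · S_{r+e}(t^m)`
  have hmul : ∀ r, ∑ c ∈ (range (p ^ (e + 1))).filter (fun c => p ∣ c),
      volkenbornSum p (fun t : ℤ_[p] => ((c : ℚ_[p]) + ((p ^ (e + 1) : ℕ) : ℚ_[p]) * (t : ℚ_[p])) ^ m) r =
      (p : ℚ_[p]) ^ m * ((p : ℚ_[p]) ^ e * volkenbornSum p g (r + e)) := by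
    intro r
    rw [pow_succ', sum_filter_dvd_range_mul, volkenbornSum_add_eq_sum_residues g r e, smul_eq_mul,
      mul_inv_cancel_left₀ (pow_ne_zero _ hp0), Finset.mul_sum]
    refine Finset.sum_congr rfl fun k _ => ?_
    rw [hfun]
    conv_rhs => rw [← smul_eq_mul, ← volkenbornSum_smul]
    congr 1
    funext t
    rw [smul_eq_mul, ← mul_pow]
    congr 1
    push_cast
    ring
  -- §1.3 the unit classes by difference
  have hunit : ∀ r, ∑ a ∈ (range (p ^ (e + 1))).filter (fun a => ¬ p ∣ a),
      volkenbornSum p (fun t : ℤ_[p] => ((a : ℚ_[p]) + ((p ^ (e + 1) : ℕ) : ℚ_[p]) * (t : ℚ_[p])) ^ m) r =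
      (p : ℚ_[p]) ^ (e + 1) * volkenbornSum p g (r + (e + 1)) -
        (p : ℚ_[p]) ^ m * ((p : ℚ_[p]) ^ e * volkenbornSum p g (r + e)) := by
    intro r
    rw [← hall r, ← hmul r, eq_sub_iff_add_eq, add_comm]
    exact Finset.sum_filter_add_sum_filter_not _ _ _
  -- §1.4 limits
  have hB : Tendsto (volkenbornSum p g) atTop (𝓝 ((bernoulli m : ℚ) : ℚ_[p])) :=
    tendsto_volkenbornSum_pow (p := p) m
  have hB1 : Tendsto (fun r => volkenbornSum p g (r + (e + 1))) atTop (𝓝 ((bernoulli m : ℚ) : ℚ_[p])) :=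
    hB.comp (tendsto_add_atTop_nat (e + 1))
  have hB0 : Tendsto (fun r => volkenbornSum p g (r + e)) atTop (𝓝 ((bernoulli m : ℚ) : ℚ_[p])) :=
    hB.comp (tendsto_add_atTop_nat e)
  have hlim := (hB1.const_mul ((p : ℚ_[p]) ^ (e + 1))).sub ((hB0.const_mul ((p : ℚ_[p]) ^ e)).const_mul
    ((p : ℚ_[p]) ^ m))
  have hval : (p : ℚ_[p]) ^ (e + 1) * ((bernoulli m : ℚ) : ℚ_[p]) -
      (p : ℚ_[p]) ^ m * ((p : ℚ_[p]) ^ e * ((bernoulli m : ℚ) : ℚ_[p])) =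
      ((p ^ (e + 1) : ℕ) : ℚ_[p]) * (1 - (p : ℚ_[p]) ^ (m - 1)) * ((bernoulli m : ℚ) : ℚ_[p]) := by
    obtain ⟨n, rfl⟩ : ∃ n, m = n + 1 := ⟨m - 1, by omega⟩
    rw [Nat.add_sub_cancel]
    push_cast
    ring
  rw [hval] at hlim
  exact hlim.congr fun r => (hunit r).symm

/-! ## §2. The uniform estimate along `m + e = (p − 1)p^M` -/

/-- `‖aⁿ − bⁿ‖ ≤ ‖a − b‖` for `‖a‖, ‖b‖ ≤ 1`. [folklore] -/
private theorem norm_pow_sub_pow_le {a b : ℚ_[p]} (ha : ‖a‖ ≤ 1) (hb : ‖b‖ ≤ 1) (n : ℕ) :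
    ‖a ^ n - b ^ n‖ ≤ ‖a - b‖ := by
  rw [← geom_sum₂_mul, norm_mul]
  refine mul_le_of_le_one_left (norm_nonneg _) ?_
  refine IsUltrametricDist.norm_sum_le_of_forall_le_of_nonneg zero_le_one fun i _ => ?_
  rw [norm_mul, norm_pow, norm_pow]
  exact mul_le_one₀ (pow_le_one₀ (norm_nonneg _) ha) (pow_nonneg (norm_nonneg _) _)
    (pow_le_one₀ (norm_nonneg _) hb)

/-- The lifting step `‖a^p − b^p‖ ≤ p⁻¹‖a − b‖` (`‖a‖, ‖b‖ ≤ 1`, `‖a − b‖ ≤ p⁻¹`). [folklore] -/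
private theorem norm_pow_prime_sub_pow_prime_le {a b : ℚ_[p]} (ha : ‖a‖ ≤ 1) (hb : ‖b‖ ≤ 1)
    (hab : ‖a - b‖ ≤ (p : ℝ)⁻¹) : ‖a ^ p - b ^ p‖ ≤ (p : ℝ)⁻¹ * ‖a - b‖ := by
  rw [← geom_sum₂_mul, norm_mul]
  refine mul_le_mul_of_nonneg_right ?_ (norm_nonneg _)
  have hsplit : ∑ i ∈ range p, a ^ i * b ^ (p - 1 - i) =
      (p : ℚ_[p]) * b ^ (p - 1) + ∑ i ∈ range p, (a ^ i - b ^ i) * b ^ (p - 1 - i) := by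
    have h : ∀ i ∈ range p,
        (a ^ i - b ^ i) * b ^ (p - 1 - i) = a ^ i * b ^ (p - 1 - i) - b ^ (p - 1) := by
      intro i hi
      have hi' := mem_range.1 hi
      rw [sub_mul, ← pow_add]
      congr 2
      omega
    rw [sum_congr rfl h, sum_sub_distrib, sum_const, card_range, nsmul_eq_mul]
    ring
  rw [hsplit]
  refine (IsUltrametricDist.norm_add_le_max _ _).trans (max_le ?_ ?_)
  · rw [norm_mul, Padic.norm_p, norm_pow]
    exact mul_le_of_le_one_right (by positivity) (pow_le_one₀ (norm_nonneg _) hb)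
  · refine IsUltrametricDist.norm_sum_le_of_forall_le_of_nonneg (by positivity) fun i _ => ?_
    rw [norm_mul, norm_pow]
    calc ‖a ^ i - b ^ i‖ * ‖b‖ ^ (p - 1 - i) ≤ ‖a - b‖ * 1 :=
          mul_le_mul (norm_pow_sub_pow_le ha hb i) (pow_le_one₀ (norm_nonneg _) hb)
            (pow_nonneg (norm_nonneg _) _) (norm_nonneg _)
      _ ≤ (p : ℝ)⁻¹ := by rw [mul_one]; exact hab

/-- Iterated lifting: `‖a^{p^M} − b^{p^M}‖ ≤ p^{−M}‖a − b‖` (`‖a‖, ‖b‖ ≤ 1`, `‖a − b‖ ≤ p⁻¹`). [folklore] -/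
private theorem norm_pow_pow_sub_le {a b : ℚ_[p]} (ha : ‖a‖ ≤ 1) (hb : ‖b‖ ≤ 1)
    (hab : ‖a - b‖ ≤ (p : ℝ)⁻¹) (M : ℕ) :
    ‖a ^ p ^ M - b ^ p ^ M‖ ≤ ((p : ℝ)⁻¹) ^ M * ‖a - b‖ := by
  induction M with
  | zero => simp
  | succ M ih =>
    have hp0 : (0 : ℝ) ≤ (p : ℝ)⁻¹ := by positivity
    have hp1 : (p : ℝ)⁻¹ ≤ 1 := inv_le_one_of_one_le₀ (by exact_mod_cast hp.out.one_lt.le)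
    have ha' : ‖a ^ p ^ M‖ ≤ 1 := by rw [norm_pow]; exact pow_le_one₀ (norm_nonneg _) ha
    have hb' : ‖b ^ p ^ M‖ ≤ 1 := by rw [norm_pow]; exact pow_le_one₀ (norm_nonneg _) hb
    have hab' : ‖a ^ p ^ M - b ^ p ^ M‖ ≤ (p : ℝ)⁻¹ := by
      refine ih.trans ?_
      calc ((p : ℝ)⁻¹) ^ M * ‖a - b‖ ≤ 1 * (p : ℝ)⁻¹ :=
            mul_le_mul (pow_le_one₀ hp0 hp1) hab (norm_nonneg _) zero_le_one
        _ = (p : ℝ)⁻¹ := one_mul _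
    have h := norm_pow_prime_sub_pow_prime_le ha' hb' hab'
    rw [← pow_mul, ← pow_mul, ← pow_succ] at h
    calc ‖a ^ p ^ (M + 1) - b ^ p ^ (M + 1)‖ ≤ (p : ℝ)⁻¹ * ‖a ^ p ^ M - b ^ p ^ M‖ := h
      _ ≤ (p : ℝ)⁻¹ * (((p : ℝ)⁻¹) ^ M * ‖a - b‖) := by gcongr
      _ = ((p : ℝ)⁻¹) ^ (M + 1) * ‖a - b‖ := by ring

/-- Fermat in `ℤ_p/pℤ_p`: `‖u^{p−1} − 1‖ ≤ p⁻¹` for a unit `u`. [folklore] -/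
private theorem norm_pow_pred_sub_one_le {u : ℚ_[p]} (hu : ‖u‖ = 1) :
    ‖u ^ (p - 1) - 1‖ ≤ (p : ℝ)⁻¹ := by
  set U : ℤ_[p] := ⟨u, hu.le⟩ with hU
  have hUnorm : ‖U‖ = 1 := hu
  have hne : PadicInt.toZMod U ≠ 0 := by
    intro h0
    have hmem : U ∈ RingHom.ker (PadicInt.toZMod : ℤ_[p] →+* ZMod p) := h0
    rw [PadicInt.ker_toZMod, IsLocalRing.mem_maximalIdeal, PadicInt.mem_nonunits] at hmem
    exact absurd hUnorm (ne_of_lt hmem)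
  have hker : U ^ (p - 1) - 1 ∈ RingHom.ker (PadicInt.toZMod : ℤ_[p] →+* ZMod p) := by
    rw [RingHom.mem_ker, map_sub, map_pow, map_one, ZMod.pow_card_sub_one_eq_one hne, sub_self]
  rw [PadicInt.ker_toZMod, IsLocalRing.mem_maximalIdeal, PadicInt.mem_nonunits] at hker
  have h' : ‖U ^ (p - 1) - 1‖ ≤ (p : ℝ) ^ (-1 : ℤ) := by
    rw [PadicInt.norm_le_pow_iff_norm_lt_pow_add_one]
    norm_num
    exact hker
  have hcoe : ((U ^ (p - 1) - 1 : ℤ_[p]) : ℚ_[p]) = u ^ (p - 1) - 1 := by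
    push_cast
    rfl
  rw [zpow_neg, zpow_one, PadicInt.norm_def, hcoe] at h'
  exact h'

/-- The Lipschitz estimate for `D(t) = (c+qt)^m − (c+qt)^{−e}`, `c` a unit, `‖q‖ ≤ p⁻¹`,
`m + e = (p−1)p^M`: `‖D(y) − D(x)‖ ≤ p^{−M}‖y − x‖`. [folklore] -/
private theorem norm_unit_diff_sub_diff_le {c q : ℚ_[p]} (hc : ‖c‖ = 1) (hq : ‖q‖ ≤ (p : ℝ)⁻¹)
    {m e M : ℕ} (hme : m + e = (p - 1) * p ^ M) (x y : ℤ_[p]) :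
    ‖((c + q * (y : ℚ_[p])) ^ m - (c + q * (y : ℚ_[p])) ^ (-(e : ℤ))) -
        ((c + q * (x : ℚ_[p])) ^ m - (c + q * (x : ℚ_[p])) ^ (-(e : ℤ)))‖ ≤
      ((p : ℝ)⁻¹) ^ M * ‖y - x‖ := by
  have hp1 : (p : ℝ)⁻¹ ≤ 1 := inv_le_one_of_one_le₀ (by exact_mod_cast hp.out.one_lt.le)
  -- units `a = c + qy`, `b = c + qx`
  have hunit : ∀ t : ℤ_[p], ‖c + q * (t : ℚ_[p])‖ = 1 := by
    intro t
    have hlt : ‖q * (t : ℚ_[p])‖ < ‖c‖ := by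
      rw [norm_mul, hc]
      calc ‖q‖ * ‖(t : ℚ_[p])‖ ≤ (p : ℝ)⁻¹ * 1 :=
            mul_le_mul hq (PadicInt.norm_le_one t) (norm_nonneg _) (by positivity)
        _ < 1 := by rw [mul_one]; exact inv_lt_one_of_one_lt₀ (by exact_mod_cast hp.out.one_lt)
    rw [Padic.add_eq_max_of_ne (ne_of_gt hlt), max_eq_left hlt.le, hc]
  set a : ℚ_[p] := c + q * (y : ℚ_[p]) with ha_def
  set b : ℚ_[p] := c + q * (x : ℚ_[p]) with hb_def
  have ha1 : ‖a‖ = 1 := hunit y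
  have hb1 : ‖b‖ = 1 := hunit x
  have ha0 : a ≠ 0 := norm_pos_iff.mp (by rw [ha1]; exact one_pos)
  have hb0 : b ≠ 0 := norm_pos_iff.mp (by rw [hb1]; exact one_pos)
  have hab : ‖a - b‖ ≤ (p : ℝ)⁻¹ * ‖y - x‖ := by
    have e1 : a - b = q * ((y - x : ℤ_[p]) : ℚ_[p]) := by
      rw [ha_def, hb_def]
      push_cast
      ring
    rw [e1, norm_mul, PadicInt.padic_norm_e_of_padicInt]
    exact mul_le_mul_of_nonneg_right hq (norm_nonneg _)
  have hab' : ‖a - b‖ ≤ ‖y - x‖ := hab.trans (mul_le_of_le_one_left (norm_nonneg _) hp1)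
  have hab'' : ‖a - b‖ ≤ (p : ℝ)⁻¹ :=
    hab.trans (mul_le_of_le_one_right (by positivity) (PadicInt.norm_le_one _))
  -- `w = v^{p−1}` is a `1`-unit, and `v^m = v^{−e} w^{p^M}`
  have hfac : ∀ v : ℚ_[p], v ≠ 0 → v ^ m = v ^ (-(e : ℤ)) * (v ^ (p - 1)) ^ p ^ M := by
    intro v hv
    rw [← pow_mul, ← hme, pow_add, zpow_neg, zpow_natCast, mul_comm, mul_assoc,
      mul_inv_cancel₀ (pow_ne_zero _ hv), mul_one]
  have hid : (a ^ m - a ^ (-(e : ℤ))) - (b ^ m - b ^ (-(e : ℤ))) =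
      a ^ (-(e : ℤ)) * ((a ^ (p - 1)) ^ p ^ M - (b ^ (p - 1)) ^ p ^ M) +
        (a ^ (-(e : ℤ)) - b ^ (-(e : ℤ))) * ((b ^ (p - 1)) ^ p ^ M - 1) := by
    rw [hfac a ha0, hfac b hb0]
    ring
  rw [hid]
  have hwa : ‖a ^ (p - 1)‖ ≤ 1 := by rw [norm_pow, ha1, one_pow]
  have hwb : ‖b ^ (p - 1)‖ ≤ 1 := by rw [norm_pow, hb1, one_pow]
  have hwab : ‖a ^ (p - 1) - b ^ (p - 1)‖ ≤ ‖a - b‖ := norm_pow_sub_pow_le ha1.le hb1.le _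
  have hae : ‖a ^ (-(e : ℤ))‖ = 1 := by rw [norm_zpow, ha1, one_zpow]
  refine (IsUltrametricDist.norm_add_le_max _ _).trans (max_le ?_ ?_)
  · rw [norm_mul, hae, one_mul]
    calc ‖(a ^ (p - 1)) ^ p ^ M - (b ^ (p - 1)) ^ p ^ M‖
        ≤ ((p : ℝ)⁻¹) ^ M * ‖a ^ (p - 1) - b ^ (p - 1)‖ :=
          norm_pow_pow_sub_le hwa hwb (hwab.trans hab'') M
      _ ≤ ((p : ℝ)⁻¹) ^ M * ‖y - x‖ := by
          gcongr
          exact hwab.trans hab'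
  · rw [norm_mul]
    have h1 : ‖a ^ (-(e : ℤ)) - b ^ (-(e : ℤ))‖ ≤ ‖y - x‖ := by
      rw [zpow_neg, zpow_neg, zpow_natCast, zpow_natCast,
        inv_sub_inv' (pow_ne_zero _ ha0) (pow_ne_zero _ hb0), norm_mul, norm_mul, norm_inv, norm_inv,
        norm_pow, norm_pow, ha1, hb1, one_pow, inv_one, one_mul, mul_one, norm_sub_rev]
      exact (norm_pow_sub_pow_le ha1.le hb1.le e).trans hab'
    have h2 : ‖(b ^ (p - 1)) ^ p ^ M - 1‖ ≤ ((p : ℝ)⁻¹) ^ M := by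
      have hF : ‖b ^ (p - 1) - 1‖ ≤ (p : ℝ)⁻¹ := norm_pow_pred_sub_one_le hb1
      have h := norm_pow_pow_sub_le hwb (b := 1) (by simp) (by simpa using hF) M
      rw [one_pow] at h
      refine h.trans ?_
      calc ((p : ℝ)⁻¹) ^ M * ‖b ^ (p - 1) - 1‖ ≤ ((p : ℝ)⁻¹) ^ M * 1 := by
            gcongr
            exact hF.trans hp1
        _ = ((p : ℝ)⁻¹) ^ M := mul_one _
    calc ‖a ^ (-(e : ℤ)) - b ^ (-(e : ℤ))‖ * ‖(b ^ (p - 1)) ^ p ^ M - 1‖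
        ≤ ‖y - x‖ * ((p : ℝ)⁻¹) ^ M := mul_le_mul h1 h2 (norm_nonneg _) (norm_nonneg _)
      _ = ((p : ℝ)⁻¹) ^ M * ‖y - x‖ := mul_comm _ _

/-- **Uniform approximation of the Riemann sums:** for a unit `c ∈ ℚ_p`, `‖q‖ ≤ p⁻¹` and
`m + e = (p − 1)p^M`, for EVERY `r`: `‖S_r((c + qt)^m) − S_r((c + qt)^{−e})‖ ≤ p · p^{−M}` — Robert's
`|∫ f| ≤ p‖f‖₁` (V.5.1 Proposition 1 (a), the tree's `norm_volkenbornSum_le`) for the difference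
`(c+qt)^{−e}((c+qt)^{(p−1)p^M} − 1)`, whose value at `0` and difference quotients are `≤ p^{−M}`; this is
the `S¹`-convergence `(c+qt)^{m_N} → (c+qt)^{1−j}` behind "the branches interpolating the values of the
Riemann zeta function at negative integers". [cite: Lai2025TwoAdicZeta, §2.2–§2.3 (Volkenborn integrals; interpolation)] -/
theorem norm_volkenbornSum_unit_pow_sub_zpow_le {c q : ℚ_[p]} (hc : ‖c‖ = 1) (hq : ‖q‖ ≤ (p : ℝ)⁻¹)
    {m e M : ℕ} (hme : m + e = (p - 1) * p ^ M) (r : ℕ) :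
    ‖volkenbornSum p (fun t : ℤ_[p] => (c + q * (t : ℚ_[p])) ^ m) r -
        volkenbornSum p (fun t : ℤ_[p] => (c + q * (t : ℚ_[p])) ^ (-(e : ℤ))) r‖ ≤
      (p : ℝ) * ((p : ℝ)⁻¹) ^ M := by
  have hp1 : (1 : ℝ) ≤ p := by exact_mod_cast hp.out.one_lt.le
  rw [← volkenbornSum_sub]
  have h := norm_volkenbornSum_le (p := p)
    (f := fun t : ℤ_[p] => (c + q * (t : ℚ_[p])) ^ m - (c + q * (t : ℚ_[p])) ^ (-(e : ℤ)))
    (M := ((p : ℝ)⁻¹) ^ M) (by positivity) (fun x y => norm_unit_diff_sub_diff_le hc hq hme x y) r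
  refine h.trans (max_le ?_ le_rfl)
  -- the value at `0`: `c^m − c^{−e} = c^{−e}((c^{p−1})^{p^M} − 1)`
  have hc0 : c ≠ 0 := norm_pos_iff.mp (by rw [hc]; exact one_pos)
  have h0 : (c + q * ((0 : ℤ_[p]) : ℚ_[p])) ^ m - (c + q * ((0 : ℤ_[p]) : ℚ_[p])) ^ (-(e : ℤ)) =
      c ^ (-(e : ℤ)) * ((c ^ (p - 1)) ^ p ^ M - 1) := by
    rw [PadicInt.coe_zero, mul_zero, add_zero, mul_sub, mul_one, ← pow_mul, ← hme, pow_add, zpow_neg,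
      zpow_natCast, mul_comm ((c ^ m)), ← mul_assoc, inv_mul_cancel₀ (pow_ne_zero _ hc0), one_mul]
  rw [h0, norm_mul, norm_zpow, hc, one_zpow, one_mul]
  have hF : ‖c ^ (p - 1) - 1‖ ≤ (p : ℝ)⁻¹ := norm_pow_pred_sub_one_le hc
  have hw : ‖c ^ (p - 1)‖ ≤ 1 := by rw [norm_pow, hc, one_pow]
  have h := norm_pow_pow_sub_le hw (b := 1) (by simp) (by simpa using hF) M
  rw [one_pow] at h
  refine h.trans ?_
  calc ((p : ℝ)⁻¹) ^ M * ‖c ^ (p - 1) - 1‖ ≤ ((p : ℝ)⁻¹) ^ M * 1 := by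
        gcongr
        exact hF.trans (inv_le_one_of_one_le₀ hp1)
    _ ≤ (p : ℝ) * ((p : ℝ)⁻¹) ^ M := by
        rw [mul_one]
        exact le_mul_of_one_le_left (by positivity) hp1

end Literature.NumberTheory.Irrationality.PAdicZetaValues
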